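import Mathlib
import HarnessLib
import Literature.Analysis.FluidPDE.SelfSimilar
import Literature.Analysis.FluidPDE.LocalTypeI
import Literature.Analysis.FluidPDE.VectorCalculus
import Literature.Analysis.FluidPDE.AxisymmetricEuler
import Literature.Analysis.UnboundedOperators.HeatKernel
import Summits.NavierStokesRegularity.NavierStokesRegularity.Theorems.PoloidalWindowDoorPoloidalWindowRigidityFlat
import Summits.NavierStokesRegularity.NavierStokesRegularity.Theorems.PoloidalWindowDoorPoloidalWindowRigiditySharp
import Summits.NavierStokesRegularity.NavierStokesRegularity.Theorems.PoloidalWindowDoorPoloidalWindowRigidityStrata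
import Summits.NavierStokesRegularity.NavierStokesRegularity.Theorems.PoloidalWindowDoorPoloidalWindowRigidityOneSlice
import Summits.NavierStokesRegularity.NavierStokesRegularity.Theorems.PoloidalWindowDoorPoloidalWindowRigidityAnyAxis

/-!
# Route `PoloidalWindowDoor` (staged, nsreg-p1), crux `PoloidalWindowRigidity` (K2) — K2 reduced to the residue
# sharpened by two more settled strata: vorticity unidirectional on NO slice, and NOT scale-invariant

Cell ns-regularity-ideate, seat p6 (route-directed support; land `--supports <PoloidalWindowRigidity item>` once the
route is born). `…Sharp.poloidalWindowRigidity_of_sharpNonflatLiouville` reduces the K2 text to the residue «class +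
poloidal along `e₃` + frozen constraint + rotational + not vertically rigid + `v·e₃` flat in no horizontal direction +
axisymmetric about no vertical axis ⇒ not backward-singular». Two further strata are tree theorems of this seat
(`…Strata.eq_zero_of_aligned`: vorticity parallel to a fixed `b ≠ 0` on ONE slice ⇒ trivial — the rank-one case,
item stmt-…-20018; `…Strata.nonflatLiouville_of_scaleInvariant`: invariant under every parabolic rescaling ⇒ Leray
self-similar ⇒ trivial by Tsai 1998), so the residue may in addition assume

* the vorticity is unidirectional on NO slice: `∀ s < 0, ∀ b ≠ 0, ∃ y, curl v(s)(y) × b ≠ 0` (in particular every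
  slice is rotational), and
* the profile is NOT scale-invariant: `∃ λ > 0, ∃ s < 0, ∃ y, λ • v(λ² s, λ y) ≠ v(s, y)`.

`poloidalWindowRigidity_of_sharperNonflatLiouville` is that reduction (conclusion VERBATIM the K2 text).

Moreover a spatial symmetry of ONE slice is a symmetry of every slice (`…OneSlice`: bounded Oseen-mild uniqueness
forward, time-analyticity backward), so the degeneracies may be excluded SLICE BY SLICE:
`poloidalWindowRigidity_of_sliceSharpNonflatLiouville` reduces the K2 text VERBATIM to the residue

  «class + poloidal along `e₃` + frozen constraint, and on EVERY slice `s < 0`: the vorticity is parallel to no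
  fixed direction (`∀ b ≠ 0, ∃ y, curl v(s)(y) × b ≠ 0`), the horizontal velocity is not vertically rigid
  (`∃ y, (Dv(s)(y)e₃)₀ ≠ 0 ∨ (Dv(s)(y)e₃)₁ ≠ 0`), `v·e₃` is flat in no horizontal direction
  (`∀ a ≠ 0, ⟪a,e₃⟫ = 0 → ∃ y, ⟪Dv(s)(y)a, e₃⟫ ≠ 0`), the slice is invariant under the translations along NO line
  (`∀ e ≠ 0, ∃ y l, v(s, y + l e) ≠ v(s, y)`; (N₁) via `…OneSlice.eq_zero_of_translate_eq_slice`) and axisymmetric about NO axis whatsoever — any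
  direction, any centre (`∀ L c, ¬ IsAxisymmetric (y ↦ L⁻¹ v(s, L y + c))`, `L` a linear isometry; the tilted axes
  are settled by `…AnyAxis`: with `ω₃ ≡ 0` the vorticity of such a slice is unidirectional); and the profile is not
  scale-invariant ⟹ not backward-singular» —

the lead may register either hypothesis as the reshaped stub instead of `…Sharp`'s.

WHAT THIS IS NOT: not a claim about Navier–Stokes regularity and not a proof of K2 — a kernel-checked reduction of K2 to
a sharper open residue, for a STAGED door route (bears_on LADDER-NS N0, rung N0-LocalTubeDoorPoloidal).
-/

noncomputable section

-- the summit and its single sub-problem share the name (CONVENTIONS §1), as in every Theorems file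
set_option linter.dupNamespace false

namespace Summit.NavierStokesRegularity.NavierStokesRegularity.Theorems.PoloidalWindowDoorPoloidalWindowRigiditySharper

open MeasureTheory Set Function Filter Topology TopologicalSpace Metric
open scoped RealInnerProductSpace InnerProductSpace
open Literature.Analysis Literature.Analysis.FluidPDE
open Summit.NavierStokesRegularity.NavierStokesRegularity.Theorems.PoloidalWindowDoorPoloidalWindowRigidityFlat
open Summit.NavierStokesRegularity.NavierStokesRegularity.Theorems.PoloidalWindowDoorPoloidalWindowRigiditySharp
open Summit.NavierStokesRegularity.NavierStokesRegularity.Theorems.PoloidalWindowDoorPoloidalWindowRigidityStrata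
open Summit.NavierStokesRegularity.NavierStokesRegularity.Theorems.PoloidalWindowDoorPoloidalWindowRigidityOneSlice
open Summit.NavierStokesRegularity.NavierStokesRegularity.Theorems.PoloidalWindowDoorPoloidalWindowRigidityAnyAxis

/-- **K2 `PoloidalWindowRigidity` reduced to the residue sharpened by the unidirectional and the scale-invariant
strata.** Hypothesis `h` = «class + poloidal along `e₃` + frozen constraint + rotational + not vertically rigid + flat in
NO horizontal direction + axisymmetric about NO vertical axis + vorticity unidirectional on NO slice + NOT scale-invariant
⟹ not backward-singular»; conclusion = the K2 text VERBATIM. Proof: `…Sharp`'s reduction, then the two case splits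
(`eq_zero_of_aligned` on the unidirectional slice, `nonflatLiouville_of_scaleInvariant`). -/
theorem poloidalWindowRigidity_of_sharperNonflatLiouville
    (h : ∀ (C : ℝ) (v : ℝ → EuclideanSpace ℝ (Fin 3) → EuclideanSpace ℝ (Fin 3)),
      Literature.Analysis.FluidPDE.HasTypeITimeDecay C v →
      ContinuousOn (Function.uncurry v) (Set.Iio (0 : ℝ) ×ˢ Set.univ) →
      (∀ s t : ℝ, s < t → t < 0 → ∀ x, v t x =
        Literature.Analysis.UnboundedOperators.heatExtension (v s) (t - s) x -
          Literature.Analysis.FluidPDE.oseenDuhamel 1 s v v t x) →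
      (∀ t < 0, Literature.Analysis.FluidPDE.VectorCalculus.IsDivFree (v t)) →
      (∀ s < 0, ∀ y, ⟪Literature.Analysis.FluidPDE.curl (v s) y, EuclideanSpace.single 2 1⟫_ℝ = 0) →
      (∀ s < 0, ∀ y, ⟪fderiv ℝ (v s) y (Literature.Analysis.FluidPDE.curl (v s) y), EuclideanSpace.single 2 1⟫_ℝ = 0) →
      (∃ s < 0, ∃ y, Literature.Analysis.FluidPDE.curl (v s) y ≠ 0) →
      (∃ s < 0, ∃ y, fderiv ℝ (v s) y (EuclideanSpace.single 2 1) 0 ≠ 0 ∨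
        fderiv ℝ (v s) y (EuclideanSpace.single 2 1) 1 ≠ 0) →
      (∀ a : EuclideanSpace ℝ (Fin 3), a ≠ 0 → ⟪a, EuclideanSpace.single 2 1⟫_ℝ = 0 →
        ∃ s < 0, ∃ y, ⟪fderiv ℝ (v s) y a, EuclideanSpace.single 2 1⟫_ℝ ≠ 0) →
      (∀ c : EuclideanSpace ℝ (Fin 3), ∃ s < 0, ¬ Literature.Analysis.FluidPDE.IsAxisymmetric (fun y => v s (y + c))) →
      (∀ s < 0, ∀ b : EuclideanSpace ℝ (Fin 3), b ≠ 0 → ∃ y,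
        Literature.Analysis.FluidPDE.cross (Literature.Analysis.FluidPDE.curl (v s) y) b ≠ 0) →
      (∃ lam : ℝ, 0 < lam ∧ ∃ s < 0, ∃ y, lam • v (lam ^ 2 * s) (lam • y) ≠ v s y) →
      ¬ Literature.Analysis.FluidPDE.IsBackwardSingularPoint v 0) :
    ∀ (C : ℝ) (v : ℝ → EuclideanSpace ℝ (Fin 3) → EuclideanSpace ℝ (Fin 3)), Literature.Analysis.FluidPDE.HasTypeITimeDecay C v → ContinuousOn (Function.uncurry v) (Set.Iio (0 : ℝ) ×ˢ Set.univ) → (∀ s t : ℝ, s < t → t < 0 → ∀ x, v t x = Literature.Analysis.UnboundedOperators.heatExtension (v s) (t - s) x - Literature.Analysis.FluidPDE.oseenDuhamel 1 s v v t x) → (∀ t < 0, Literature.Analysis.FluidPDE.VectorCalculus.IsDivFree (v t)) → (∀ s < 0, Continuous (Literature.Analysis.FluidPDE.curl (v s))) ∧ ∀ (e : EuclideanSpace ℝ (Fin 3)), e ≠ 0 → (∀ s < 0, ∃ U : Set (EuclideanSpace ℝ (Fin 3)), IsOpen U ∧ U.Nonempty ∧ ∀ y ∈ U, ⟪Literature.Analysis.FluidPDE.curl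 (v s) y, e⟫_ℝ = 0) → ¬ Literature.Analysis.FluidPDE.IsBackwardSingularPoint v 0 := by
  refine poloidalWindowRigidity_of_sharpNonflatLiouville
    fun C v hrate hcont hmild hdiv hpol hfi hrot hvr hflat haxi => ?_
  -- unidirectional vorticity on some slice: the rank-one stratum
  by_cases hal : ∃ s < 0, ∃ b : EuclideanSpace ℝ (Fin 3), b ≠ 0 ∧
      ∀ y, Literature.Analysis.FluidPDE.cross (Literature.Analysis.FluidPDE.curl (v s) y) b = 0
  · obtain ⟨s, hs, b, hb, hb'⟩ := hal
    exact not_backwardSingular_of_zero (eq_zero_of_aligned hrate hcont hmild hdiv hb hs hb')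
  -- scale-invariant: the self-similar stratum (Tsai)
  by_cases hsc : ∀ lam : ℝ, 0 < lam → ∀ s < 0, ∀ y, lam • v (lam ^ 2 * s) (lam • y) = v s y
  · exact nonflatLiouville_of_scaleInvariant hrate hcont hmild hdiv hsc
  · push Not at hal hsc
    refine h C v hrate hcont hmild hdiv hpol hfi hrot hvr hflat haxi (fun s hs b hb => hal s hs b hb) ?_
    obtain ⟨lam, hlam, s, hs, y, hy⟩ := hsc
    exact ⟨lam, hlam, s, hs, y, hy⟩

/-- **K2 `PoloidalWindowRigidity` reduced to the SLICE-WISE sharpened residue.** Hypothesis `h` = «class + poloidal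
along `e₃` + frozen constraint + on EVERY slice: vorticity parallel to no fixed direction, not vertically rigid, `v·e₃`
flat in no horizontal direction, invariant under the translations along NO line, axisymmetric about NO axis (any direction
`L e₃`, any centre `c`) + NOT scale-invariant ⟹ not backward-singular»; conclusion = the K2 text VERBATIM. Proof: `poloidalWindowRigidity_of_sharperNonflatLiouville`,
then the one-slice strata (`…OneSlice.nonflatLiouville_of_vertRigid_slice`, `…OneSlice.nonflatLiouville_of_flat_slice`,
`…AnyAxis.nonflatLiouville_of_axisymmetric_anyAxis_slice`) dispose of a degenerate slice. -/
theorem poloidalWindowRigidity_of_sliceSharpNonflatLiouville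
    (h : ∀ (C : ℝ) (v : ℝ → EuclideanSpace ℝ (Fin 3) → EuclideanSpace ℝ (Fin 3)),
      Literature.Analysis.FluidPDE.HasTypeITimeDecay C v →
      ContinuousOn (Function.uncurry v) (Set.Iio (0 : ℝ) ×ˢ Set.univ) →
      (∀ s t : ℝ, s < t → t < 0 → ∀ x, v t x =
        Literature.Analysis.UnboundedOperators.heatExtension (v s) (t - s) x -
          Literature.Analysis.FluidPDE.oseenDuhamel 1 s v v t x) →
      (∀ t < 0, Literature.Analysis.FluidPDE.VectorCalculus.IsDivFree (v t)) →
      (∀ s < 0, ∀ y, ⟪Literature.Analysis.FluidPDE.curl (v s) y, EuclideanSpace.single 2 1⟫_ℝ = 0) →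
      (∀ s < 0, ∀ y, ⟪fderiv ℝ (v s) y (Literature.Analysis.FluidPDE.curl (v s) y), EuclideanSpace.single 2 1⟫_ℝ = 0) →
      (∀ s < 0, ∀ b : EuclideanSpace ℝ (Fin 3), b ≠ 0 → ∃ y,
        Literature.Analysis.FluidPDE.cross (Literature.Analysis.FluidPDE.curl (v s) y) b ≠ 0) →
      (∀ s < 0, ∃ y, fderiv ℝ (v s) y (EuclideanSpace.single 2 1) 0 ≠ 0 ∨
        fderiv ℝ (v s) y (EuclideanSpace.single 2 1) 1 ≠ 0) →
      (∀ s < 0, ∀ a : EuclideanSpace ℝ (Fin 3), a ≠ 0 → ⟪a, EuclideanSpace.single 2 1⟫_ℝ = 0 →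
        ∃ y, ⟪fderiv ℝ (v s) y a, EuclideanSpace.single 2 1⟫_ℝ ≠ 0) →
      (∀ s < 0, ∀ e : EuclideanSpace ℝ (Fin 3), e ≠ 0 → ∃ (y : EuclideanSpace ℝ (Fin 3)) (l : ℝ), v s (y + l • e) ≠ v s y) →
      (∀ s < 0, ∀ (L : EuclideanSpace ℝ (Fin 3) ≃ₗᵢ[ℝ] EuclideanSpace ℝ (Fin 3)) (c : EuclideanSpace ℝ (Fin 3)),
        ¬ Literature.Analysis.FluidPDE.IsAxisymmetric (fun y => L.symm (v s (L y + c)))) →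
      (∃ lam : ℝ, 0 < lam ∧ ∃ s < 0, ∃ y, lam • v (lam ^ 2 * s) (lam • y) ≠ v s y) →
      ¬ Literature.Analysis.FluidPDE.IsBackwardSingularPoint v 0) :
    ∀ (C : ℝ) (v : ℝ → EuclideanSpace ℝ (Fin 3) → EuclideanSpace ℝ (Fin 3)), Literature.Analysis.FluidPDE.HasTypeITimeDecay C v → ContinuousOn (Function.uncurry v) (Set.Iio (0 : ℝ) ×ˢ Set.univ) → (∀ s t : ℝ, s < t → t < 0 → ∀ x, v t x = Literature.Analysis.UnboundedOperators.heatExtension (v s) (t - s) x - Literature.Analysis.FluidPDE.oseenDuhamel 1 s v v t x) → (∀ t < 0, Literature.Analysis.FluidPDE.VectorCalculus.IsDivFree (v t)) → (∀ s < 0, Continuous (Literature.Analysis.FluidPDE.curl (v s))) ∧ ∀ (e : EuclideanSpace ℝ (Fin 3)), e ≠ 0 → (∀ s < 0, ∃ U : Set (EuclideanSpace ℝ (Fin 3)), IsOpen U ∧ U.Nonempty ∧ ∀ y ∈ U, ⟪Literature.Analysis.FluidPDE.curl (v s) y, e⟫_ℝ = 0) → ¬ Literature.Analysis.FluidPDE.IsBackwardSingularPoint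 v 0 := by
  refine poloidalWindowRigidity_of_sharperNonflatLiouville
    fun C v hrate hcont hmild hdiv hpol hfi _hrot _hvr _hflat _haxi huni hsc => ?_
  -- a slice invariant under the translations along some line
  by_cases htr : ∃ s < 0, ∃ e : EuclideanSpace ℝ (Fin 3), e ≠ 0 ∧
      ∀ (y : EuclideanSpace ℝ (Fin 3)) (l : ℝ), v s (y + l • e) = v s y
  · obtain ⟨s, hs, e, he, htr'⟩ := htr
    exact nonflatLiouville_of_translate_eq_slice hrate hcont hmild hdiv hs he htr'
  -- a vertically rigid slice
  by_cases hvr : ∃ s < 0, ∀ y, fderiv ℝ (v s) y (EuclideanSpace.single 2 1) 0 = 0 ∧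
      fderiv ℝ (v s) y (EuclideanSpace.single 2 1) 1 = 0
  · obtain ⟨s, hs, hy⟩ := hvr
    exact nonflatLiouville_of_vertRigid_slice hrate hcont hmild hdiv hs (fun y => (hy y).1) fun y => (hy y).2
  -- a slice flat in some horizontal direction
  by_cases hflat : ∃ s < 0, ∃ a : EuclideanSpace ℝ (Fin 3), a ≠ 0 ∧ ⟪a, EuclideanSpace.single 2 1⟫_ℝ = 0 ∧
      ∀ y, ⟪fderiv ℝ (v s) y a, EuclideanSpace.single 2 1⟫_ℝ = 0
  · obtain ⟨s, hs, a, ha, ha3, hfl⟩ := hflat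
    exact nonflatLiouville_of_flat_slice hrate hcont hmild hdiv hs (hpol s hs) ha ha3 hfl
  -- a slice axisymmetric about some axis (any direction, any centre)
  by_cases haxi : ∃ s < 0, ∃ (L : EuclideanSpace ℝ (Fin 3) ≃ₗᵢ[ℝ] EuclideanSpace ℝ (Fin 3)) (c : EuclideanSpace ℝ (Fin 3)),
      Literature.Analysis.FluidPDE.IsAxisymmetric (fun y => L.symm (v s (L y + c)))
  · obtain ⟨s, hs, L, c, hc⟩ := haxi
    exact nonflatLiouville_of_axisymmetric_anyAxis_slice hrate hcont hmild hdiv hpol L c hs hc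
  · push Not at htr hvr hflat haxi
    refine h C v hrate hcont hmild hdiv hpol hfi huni (fun s hs => ?_) (fun s hs a ha ha3 => hflat s hs a ha ha3)
      (fun s hs e he => ?tr) haxi hsc
    case tr =>
      obtain ⟨y, l, hyl⟩ := htr s hs e he
      exact ⟨y, l, hyl⟩
    obtain ⟨y, hy⟩ := hvr s hs
    refine ⟨y, ?_⟩
    by_cases h0 : fderiv ℝ (v s) y (EuclideanSpace.single 2 1) 0 = 0
    · exact Or.inr (hy h0)
    · exact Or.inl h0

end Summit.NavierStokesRegularity.NavierStokesRegularity.Theorems.PoloidalWindowDoorPoloidalWindowRigiditySharper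

end
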